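import Mathlib
import HarnessLib
import Summits.NavierStokesRegularity.NavierStokesRegularity.Theorems.PoloidalWindowDoorLrcModEntireSeparatedHarmonic
import Summits.NavierStokesRegularity.NavierStokesRegularity.Theorems.PoloidalWindowDoorLrcModEntireSheetDataRigidity
import Summits.NavierStokesRegularity.NavierStokesRegularity.Theorems.PoloidalWindowDoorLrcModEntireParallelWebsIdentity

/-!
# Route `PoloidalWindowDoor`, item `LrcModEntire` (stmt-NavierStokesRegularity-20428), cell (Q4-sonic, straight, μ < 0) `stub_Q4sonicLineNeg`, case I —
# THE TRIGONOMETRIC LAW FOR THE SHEET FUNCTIONS, abstract form (S3 of the assembly A-I, T2B-g17 §5(5c) / §7 S3 / §8)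

Cell ns-regularity-ideate, stub-worker seat ns-poloidal-K2-p2 g17 under the LEAD of item 20428 (ns-poloidal-K2-p3 g17, PICK 2026-08-29T20:07:35Z «S3 WIRING =
the sheet-data dichotomy at class level»); `--supports stmt-NavierStokesRegularity-20428 --as helper`.  Class-free real analysis; the u-level core is
`…SonicSheetStrain`, the package wrapper follows.

On a sonic web sheet of `e`-parallel lines the two sheet functions `F₁ = U·e∘W`, `F₂ = U·Je∘W` satisfy the Cauchy–Riemann pair of `…Q4SonicSheetCR`
(`∂_z F₁ = d′·∂_s F₂`, `∂_z F₂ = d′·(c − ∂_s F₁)`, `d′ ≠ 0`), and the speed law + cubic transport put `F₂` in the SEPARATED FORM `F₂(s,z) = G(z) + Ẽ(z)·A(s)`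
(`Ẽ ≠ 0`; in case I the web speed is `s`-free, so there is NO free `α(s)`; `A` is bounded because `F₂` is).  Three layers:

* `const_or_sinusoid_of_ode_bounded` (Layer 1) — `e·A″ + P·A + Q = 0` with CONSTANT coefficients (`e ≠ 0`) and `A` bounded ⇒ `A` is constant OR
  `A(s) = k + c₁cos(ωs) + c₂sin(ωs)` with `ω > 0`, `(c₁,c₂) ≠ (0,0)` (trichotomy on `λ = P/e` over LEAD's `sinusoid_of_ode` / `const_of_ode_zero_bounded` /
  `const_of_ode_neg_bounded`).  NB: because `α ≡ const` in case I, the separated identity AT ONE HEIGHT `z₀` is already such an ODE — no `z`-derivative of the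
  coefficients is taken (cf. `sProfile_ode_of_separated`), so no smoothness of the slope `μ` beyond the binder's `C³` is consumed downstream.
* `sProfile_identity_of_CR` (Layer 2) — the identity `d′Ẽ·A″(s) + (Ẽ′/d′)′·A(s) + (G′/d′)′ = 0` from the SYMMETRY OF THE MIXED PARTIALS of `F₁ ∈ C²`
  (`ContDiffAt.isSymmSndFDerivAt`), given `∂_z F₁ = d′ẼA′` and `∂_s F₁ = c − (G′ + Ẽ′A)/d′`.
* ★ `sheet_trig_of_separated` (Layer 3) — CR pair + separated form + `F₁(·,z)`, `F₂(·,z₀)` bounded ⊢ EITHER `∂_s F₁ = ∂_s F₂ = 0` on `ℝ × I` (the web-frame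
  strain row `(S_ee, S_eν)` vanishes: `s`-FREE sheet data) OR there is ONE frequency `ω > 0` with `F₁(s,z) = a₀(z) + a₁(z)cos(ωs) + b₁(z)sin(ωs)`,
  `F₂(s,z) = a₀′(z) + a₁′(z)cos(ωs) + b₁′(z)sin(ωs)` and `(a₁′(z), b₁′(z)) ≠ (0,0)` at every height (PERIODIC sheet data, period `2π/ω`; LEAD's
  `eq_add_of_hasDerivAt_bounded` kills the secular slope of `F₁`).

WHAT THIS IS NOT: not a claim about Navier–Stokes regularity and not a stub of the registry; class-free lemmas for the residual research cell `stub_Q4sonicLineNeg`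
of `Cruxes/LrcModEntire/Lines/twist_split.lean` v13 (bears_on LADDER-NS N0 via item 20428; items 20428 / 19708 / 27893 OPEN).
-/

noncomputable section

set_option linter.dupNamespace false
set_option linter.style.longLine false

namespace Summit.NavierStokesRegularity.NavierStokesRegularity.Theorems.PoloidalWindowDoorLrcModEntireSonicSheetTrig

open Set Function Filter Topology
open scoped RealInnerProductSpace InnerProductSpace
open Summit.NavierStokesRegularity.NavierStokesRegularity.Theorems.PoloidalWindowDoorLrcModEntireSeparatedHarmonic
open Summit.NavierStokesRegularity.NavierStokesRegularity.Theorems.PoloidalWindowDoorLrcModEntireSheetDataRigidity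
open Summit.NavierStokesRegularity.NavierStokesRegularity.Theorems.PoloidalWindowDoorLrcModEntireParallelWebsIdentity

/-! ### Layer 1: a bounded solution of `e·A″ + P·A + Q = 0` (constants, `e ≠ 0`) is constant or a non-trivial sinusoid -/

/-- **Bounded solutions of a constant-coefficient second-order identity.**  If `A` is twice differentiable on ℝ with `e·A″(s) + P·A(s) + Q = 0` for all `s`
(`e ≠ 0`) and `A` is bounded, then EITHER `A` is constant OR `A(s) = k + c₁cos(ωs) + c₂sin(ωs)` with `ω > 0` and `(c₁, c₂) ≠ (0, 0)`
(trichotomy on `λ = P/e`: `…SeparatedHarmonic.sinusoid_of_ode` / `const_of_ode_zero_bounded` / `const_of_ode_neg_bounded`). -/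
theorem const_or_sinusoid_of_ode_bounded {A A' A'' : ℝ → ℝ} {e P Q M : ℝ} (he : e ≠ 0)
    (hA : ∀ s, HasDerivAt A (A' s) s) (hA' : ∀ s, HasDerivAt A' (A'' s) s)
    (hid : ∀ s, e * A'' s + P * A s + Q = 0) (hbdd : ∀ s, |A s| ≤ M) :
    (∀ s, A s = A 0) ∨
      (∃ w k c₁ c₂ : ℝ, 0 < w ∧ (c₁ ≠ 0 ∨ c₂ ≠ 0) ∧ ∀ s, A s = k + c₁ * Real.cos (w * s) + c₂ * Real.sin (w * s)) := by
  set lam : ℝ := P / e with hlam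
  set m : ℝ := Q / e with hm
  have hA'' : ∀ s, HasDerivAt A' (-lam * A s - m) s := by
    intro s
    have h := hid s
    have e1 : A'' s = -lam * A s - m := by
      rw [hlam, hm]
      field_simp
      linarith
    rw [← e1]
    exact hA' s
  rcases lt_trichotomy 0 lam with hpos | hzero | hneg
  · -- `λ > 0`: a sinusoid, possibly trivial
    have hform := sinusoid_of_ode hpos hA hA''
    by_cases hc : A 0 + m / lam = 0 ∧ A' 0 / Real.sqrt lam = 0
    · left
      have key : ∀ x, A x = -m / lam := fun x => by
        rw [hform x, hc.1, hc.2]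
        simp
      intro s
      rw [key s, key 0]
    · right
      refine ⟨Real.sqrt lam, -m / lam, A 0 + m / lam, A' 0 / Real.sqrt lam, Real.sqrt_pos.2 hpos, ?_, fun s => hform s⟩
      rcases not_and_or.1 hc with h1 | h2
      · exact Or.inl h1
      · exact Or.inr h2
  · -- `λ = 0`
    left
    have hA''0 : ∀ s, HasDerivAt A' (-m) s := by
      intro s
      have h := hA'' s
      rw [← hzero] at h
      simpa using h
    exact fun s => const_of_ode_zero_bounded hA hA''0 hbdd s
  · -- `λ < 0`
    left
    intro s
    rw [const_of_ode_neg_bounded hneg hA hA'' hbdd s, const_of_ode_neg_bounded hneg hA hA'' hbdd 0]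


/-! ### Layer 2: the `s`-profile identity from the mixed partials of the along-web sheet function -/

/-- Derivative of a partial derivative of a `C²` function along a coordinate line (second parameter). -/
theorem hasDerivAt_fderiv_apply_snd {F : ℝ × ℝ → ℝ} {p : ℝ × ℝ} (hF : ContDiffAt ℝ 2 F p) (v : ℝ × ℝ) :
    HasDerivAt (fun z' : ℝ => fderiv ℝ F (p.1, z') v) (fderiv ℝ (fderiv ℝ F) p ((0 : ℝ), (1 : ℝ)) v) p.2 := by
  have hd : DifferentiableAt ℝ (fderiv ℝ F) p := (hF.fderiv_right (m := 1) (by norm_num)).differentiableAt (by norm_num)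
  have h1 : HasFDerivAt (fun q => fderiv ℝ F q v) ((fderiv ℝ (fderiv ℝ F) p).flip v) p := by
    have h := hd.hasFDerivAt.clm_apply (hasFDerivAt_const v p)
    simpa using h
  have hline : HasDerivAt (fun z' : ℝ => ((p.1, z') : ℝ × ℝ)) ((0 : ℝ), (1 : ℝ)) p.2 :=
    (hasDerivAt_const p.2 p.1).prodMk (hasDerivAt_id p.2)
  exact h1.comp_hasDerivAt p.2 hline

/-- Derivative of a partial derivative of a `C²` function along a coordinate line (first parameter). -/
theorem hasDerivAt_fderiv_apply_fst {F : ℝ × ℝ → ℝ} {p : ℝ × ℝ} (hF : ContDiffAt ℝ 2 F p) (v : ℝ × ℝ) :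
    HasDerivAt (fun s' : ℝ => fderiv ℝ F (s', p.2) v) (fderiv ℝ (fderiv ℝ F) p ((1 : ℝ), (0 : ℝ)) v) p.1 := by
  have hd : DifferentiableAt ℝ (fderiv ℝ F) p := (hF.fderiv_right (m := 1) (by norm_num)).differentiableAt (by norm_num)
  have h1 : HasFDerivAt (fun q => fderiv ℝ F q v) ((fderiv ℝ (fderiv ℝ F) p).flip v) p := by
    have h := hd.hasFDerivAt.clm_apply (hasFDerivAt_const v p)
    simpa using h
  have hline : HasDerivAt (fun s' : ℝ => ((s', p.2) : ℝ × ℝ)) ((1 : ℝ), (0 : ℝ)) p.1 :=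
    (hasDerivAt_id p.1).prodMk (hasDerivAt_const p.1 p.2)
  exact h1.comp_hasDerivAt p.1 hline

/-- **The `s`-profile identity from the mixed partials** (T2B-g17 §2(2d) with `α ≡ const`, i.e. case I).  On `ℝ × I` (`I` open) let `F₁` be `C²` near every
point of the region, with `∂_z F₁(s,z) = dE(z)·A′(s)` (first Cauchy–Riemann identity: `∂_z f₁ = d′∂_s f₂`, `∂_s f₂ = ẼA′`, `dE = d′Ẽ`) and
`∂_s F₁(s,z) = c − (GP(z) + EP(z)·A(s))` (second identity: `∂_s f₁ = c − ∂_z f₂/d′`, `∂_z f₂ = G′ + Ẽ′A`, `GP = G′/d′`, `EP = Ẽ′/d′`), `EP′ = P`, `GP′ = Q` on `I`,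
`A″` the second derivative of `A`.  Then **`dE(z)·A″(s) + P(z)·A(s) + Q(z) = 0`** for all `s` and `z ∈ I`. -/
theorem sProfile_identity_of_CR {I : Set ℝ} (hI : IsOpen I) {F₁ : ℝ × ℝ → ℝ} (hF₁ : ContDiffOn ℝ 2 F₁ (region I))
    {A A' A'' dE EP GP P Q : ℝ → ℝ} {c : ℝ}
    (hA' : ∀ s, HasDerivAt A' (A'' s) s)
    (hCR1 : ∀ s : ℝ, ∀ z ∈ I, fderiv ℝ F₁ (s, z) ((0 : ℝ), (1 : ℝ)) = dE z * A' s)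
    (hCR2 : ∀ s : ℝ, ∀ z ∈ I, fderiv ℝ F₁ (s, z) ((1 : ℝ), (0 : ℝ)) = c - (GP z + EP z * A s))
    (hEP : ∀ z ∈ I, HasDerivAt EP (P z) z) (hGP : ∀ z ∈ I, HasDerivAt GP (Q z) z)
    (s : ℝ) {z : ℝ} (hz : z ∈ I) :
    dE z * A'' s + P z * A s + Q z = 0 := by
  have hp : ((s, z) : ℝ × ℝ) ∈ region I := hz
  have hF : ContDiffAt ℝ 2 F₁ (s, z) := hF₁.contDiffAt ((isOpen_region hI).mem_nhds hp)
  -- symmetry of the second derivative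
  have hsymm : fderiv ℝ (fderiv ℝ F₁) (s, z) ((0 : ℝ), (1 : ℝ)) ((1 : ℝ), (0 : ℝ)) =
      fderiv ℝ (fderiv ℝ F₁) (s, z) ((1 : ℝ), (0 : ℝ)) ((0 : ℝ), (1 : ℝ)) :=
    hF.isSymmSndFDerivAt (by simp) _ _
  -- `∂_z(∂_s F₁)(s,z) = −(Q z + P z·A s)`
  have h1 : HasDerivAt (fun z' : ℝ => fderiv ℝ F₁ (s, z') ((1 : ℝ), (0 : ℝ)))
      (fderiv ℝ (fderiv ℝ F₁) (s, z) ((0 : ℝ), (1 : ℝ)) ((1 : ℝ), (0 : ℝ))) z :=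
    hasDerivAt_fderiv_apply_snd (p := (s, z)) hF _
  have h1' : HasDerivAt (fun z' : ℝ => fderiv ℝ F₁ (s, z') ((1 : ℝ), (0 : ℝ))) (-(Q z + P z * A s)) z := by
    have hrhs : HasDerivAt (fun z' : ℝ => c - (GP z' + EP z' * A s)) (-(Q z + P z * A s)) z := by
      have h := ((hGP z hz).add ((hEP z hz).mul_const (A s))).const_sub c
      simpa using h
    refine hrhs.congr_of_eventuallyEq ?_
    filter_upwards [hI.mem_nhds hz] with z' hz' using hCR2 s z' hz'
  have hzs : fderiv ℝ (fderiv ℝ F₁) (s, z) ((0 : ℝ), (1 : ℝ)) ((1 : ℝ), (0 : ℝ)) = -(Q z + P z * A s) := h1.unique h1'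
  -- `∂_s(∂_z F₁)(s,z) = dE z·A″ s`
  have h2 : HasDerivAt (fun s' : ℝ => fderiv ℝ F₁ (s', z) ((0 : ℝ), (1 : ℝ)))
      (fderiv ℝ (fderiv ℝ F₁) (s, z) ((1 : ℝ), (0 : ℝ)) ((0 : ℝ), (1 : ℝ))) s :=
    hasDerivAt_fderiv_apply_fst (p := (s, z)) hF _
  have h2' : HasDerivAt (fun s' : ℝ => fderiv ℝ F₁ (s', z) ((0 : ℝ), (1 : ℝ))) (dE z * A'' s) s := by
    have hrhs : HasDerivAt (fun s' : ℝ => dE z * A' s') (dE z * A'' s) s := (hA' s).const_mul (dE z)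
    refine hrhs.congr_of_eventuallyEq (Filter.Eventually.of_forall fun s' => ?_)
    exact hCR1 s' z hz
  have hsz : fderiv ℝ (fderiv ℝ F₁) (s, z) ((1 : ℝ), (0 : ℝ)) ((0 : ℝ), (1 : ℝ)) = dE z * A'' s := h2.unique h2'
  rw [hsz, hzs] at hsymm
  linarith


/-! ### Layer 3: from the separated form of the cross-web sheet function to the trigonometric law for both sheet functions -/

/-- Partial derivative along the first parameter of a function differentiable at `p`, as the derivative of the slice. -/
theorem hasDerivAt_slice_fst {F : ℝ × ℝ → ℝ} {p : ℝ × ℝ} (hF : DifferentiableAt ℝ F p) :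
    HasDerivAt (fun s' : ℝ => F (s', p.2)) (fderiv ℝ F p ((1 : ℝ), (0 : ℝ))) p.1 := by
  have hline : HasDerivAt (fun s' : ℝ => ((s', p.2) : ℝ × ℝ)) ((1 : ℝ), (0 : ℝ)) p.1 :=
    (hasDerivAt_id p.1).prodMk (hasDerivAt_const p.1 p.2)
  exact hF.hasFDerivAt.comp_hasDerivAt p.1 hline

/-- Partial derivative along the second parameter of a function differentiable at `p`, as the derivative of the slice. -/
theorem hasDerivAt_slice_snd {F : ℝ × ℝ → ℝ} {p : ℝ × ℝ} (hF : DifferentiableAt ℝ F p) :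
    HasDerivAt (fun z' : ℝ => F (p.1, z')) (fderiv ℝ F p ((0 : ℝ), (1 : ℝ))) p.2 := by
  have hline : HasDerivAt (fun z' : ℝ => ((p.1, z') : ℝ × ℝ)) ((0 : ℝ), (1 : ℝ)) p.2 :=
    (hasDerivAt_const p.2 p.1).prodMk (hasDerivAt_id p.2)
  exact hF.hasFDerivAt.comp_hasDerivAt p.2 hline

/-- **THE TRIGONOMETRIC LAW FOR THE SHEET FUNCTIONS (abstract form).**  On `ℝ × I` (`I` open, `z₀ ∈ I`) let `F₁ ∈ C²`, `F₂ ∈ C¹` near the region satisfy the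
Cauchy–Riemann pair `∂_z F₁ = d′·∂_s F₂`, `∂_z F₂ = d′·(c − ∂_s F₁)` (`d′ ≠ 0`), let `F₂` have the SEPARATED FORM `F₂(s,z) = G(z) + Ẽ(z)·A(s)` (`Ẽ ≠ 0`; `G, Ẽ`
differentiable with `G′/d′`, `Ẽ′/d′` differentiable on `I`; `A` twice differentiable), and let every `F₁(·,z)` and `F₂(·,z₀)` be bounded (so `A` is bounded).  Then EITHER the strain row
vanishes — `∂_s F₁ = ∂_s F₂ = 0` on `ℝ × I` — OR there are `ω > 0` and coefficient functions with `F₁(s,z) = a₀(z) + a₁(z)cos(ωs) + b₁(z)sin(ωs)`,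
`F₂(s,z) = a₀′(z) + a₁′(z)cos(ωs) + b₁′(z)sin(ωs)` on `ℝ × I` and `(a₁′(z), b₁′(z)) ≠ (0,0)` for every `z ∈ I` (T2B-g17 §5(5c)). -/
theorem sheet_trig_of_separated {I : Set ℝ} (hI : IsOpen I) {z₀ : ℝ} (hz₀ : z₀ ∈ I)
    {F₁ F₂ : ℝ × ℝ → ℝ} (hF₁ : ContDiffOn ℝ 2 F₁ (region I)) (hF₂ : ContDiffOn ℝ 1 F₂ (region I))
    {A A' A'' G G' Et Et' dd P Q B : ℝ → ℝ} {c M : ℝ}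
    (hA : ∀ s, HasDerivAt A (A' s) s) (hA' : ∀ s, HasDerivAt A' (A'' s) s)
    (hsep : ∀ s : ℝ, ∀ z ∈ I, F₂ (s, z) = G z + Et z * A s) (hF₂bdd : ∀ s : ℝ, |F₂ (s, z₀)| ≤ M)
    (hG : ∀ z ∈ I, HasDerivAt G (G' z) z) (hEt : ∀ z ∈ I, HasDerivAt Et (Et' z) z) (hEt0 : ∀ z ∈ I, Et z ≠ 0)
    (hdd : ∀ z ∈ I, dd z ≠ 0)
    (hP : ∀ z ∈ I, HasDerivAt (fun z' => Et' z' / dd z') (P z) z) (hQ : ∀ z ∈ I, HasDerivAt (fun z' => G' z' / dd z') (Q z) z)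
    (hCR1 : ∀ s : ℝ, ∀ z ∈ I, fderiv ℝ F₁ (s, z) ((0 : ℝ), (1 : ℝ)) = dd z * fderiv ℝ F₂ (s, z) ((1 : ℝ), (0 : ℝ)))
    (hCR2 : ∀ s : ℝ, ∀ z ∈ I, fderiv ℝ F₂ (s, z) ((0 : ℝ), (1 : ℝ)) = dd z * (c - fderiv ℝ F₁ (s, z) ((1 : ℝ), (0 : ℝ))))
    (hF₁bdd : ∀ z ∈ I, ∀ s : ℝ, |F₁ (s, z)| ≤ B z) :
    (∀ s : ℝ, ∀ z ∈ I, fderiv ℝ F₁ (s, z) ((1 : ℝ), (0 : ℝ)) = 0 ∧ fderiv ℝ F₂ (s, z) ((1 : ℝ), (0 : ℝ)) = 0) ∨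
    (∃ w : ℝ, 0 < w ∧ ∃ a₀ a₁ b₁ a₀' a₁' b₁' : ℝ → ℝ, (∀ z ∈ I, a₁' z ≠ 0 ∨ b₁' z ≠ 0) ∧
      ∀ s : ℝ, ∀ z ∈ I, F₁ (s, z) = a₀ z + a₁ z * Real.cos (w * s) + b₁ z * Real.sin (w * s) ∧
        F₂ (s, z) = a₀' z + a₁' z * Real.cos (w * s) + b₁' z * Real.sin (w * s)) := by
  have hreg : ∀ s : ℝ, ∀ z ∈ I, ((s, z) : ℝ × ℝ) ∈ region I := fun s z hz => hz
  -- `A` is bounded because `F₂(·,z₀) = G(z₀) + Et(z₀)·A` is (`Et(z₀) ≠ 0`)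
  have hAbdd : ∀ s, |A s| ≤ (M + |G z₀|) / |Et z₀| := by
    intro s
    have hEt := hEt0 z₀ hz₀
    rw [le_div_iff₀ (abs_pos.2 hEt), ← abs_mul]
    have h : A s * Et z₀ = F₂ (s, z₀) - G z₀ := by rw [hsep s z₀ hz₀]; ring
    rw [h]
    exact (abs_sub _ _).trans (by linarith [hF₂bdd s])
  have hF₁d : ∀ s : ℝ, ∀ z ∈ I, DifferentiableAt ℝ F₁ (s, z) := fun s z hz =>
    (hF₁.contDiffAt ((isOpen_region hI).mem_nhds (hreg s z hz))).differentiableAt (by norm_num)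
  have hF₂d : ∀ s : ℝ, ∀ z ∈ I, DifferentiableAt ℝ F₂ (s, z) := fun s z hz =>
    (hF₂.contDiffAt ((isOpen_region hI).mem_nhds (hreg s z hz))).differentiableAt (by norm_num)
  -- (a) `∂_s F₂ = Et·A′`
  have hsF₂ : ∀ s : ℝ, ∀ z ∈ I, fderiv ℝ F₂ (s, z) ((1 : ℝ), (0 : ℝ)) = Et z * A' s := by
    intro s z hz
    have h1 : HasDerivAt (fun s' : ℝ => F₂ (s', z)) (fderiv ℝ F₂ (s, z) ((1 : ℝ), (0 : ℝ))) s := hasDerivAt_slice_fst (hF₂d s z hz)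
    have h2 : HasDerivAt (fun s' : ℝ => G z + Et z * A s') (Et z * A' s) s := by
      simpa using ((hA s).const_mul (Et z)).const_add (G z)
    have heq : (fun s' : ℝ => F₂ (s', z)) = fun s' => G z + Et z * A s' := funext fun s' => hsep s' z hz
    rw [heq] at h1
    exact h1.unique h2
  -- (b) `∂_z F₂ = G′ + Et′·A`
  have hzF₂ : ∀ s : ℝ, ∀ z ∈ I, fderiv ℝ F₂ (s, z) ((0 : ℝ), (1 : ℝ)) = G' z + Et' z * A s := by
    intro s z hz
    have h1 : HasDerivAt (fun z' : ℝ => F₂ (s, z')) (fderiv ℝ F₂ (s, z) ((0 : ℝ), (1 : ℝ))) z := hasDerivAt_slice_snd (hF₂d s z hz)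
    have h2 : HasDerivAt (fun z' : ℝ => G z' + Et z' * A s) (G' z + Et' z * A s) z := (hG z hz).add ((hEt z hz).mul_const (A s))
    have heq : (fun z' : ℝ => G z' + Et z' * A s) =ᶠ[𝓝 z] fun z' => F₂ (s, z') := by
      filter_upwards [hI.mem_nhds hz] with z' hz' using (hsep s z' hz').symm
    exact (h1.congr_of_eventuallyEq heq).unique h2
  -- (c) the two identities in the shape of Layer 2
  have hCR2' : ∀ s : ℝ, ∀ z ∈ I, fderiv ℝ F₁ (s, z) ((1 : ℝ), (0 : ℝ)) = c - (G' z / dd z + Et' z / dd z * A s) := by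
    intro s z hz
    have h := hCR2 s z hz
    rw [hzF₂ s z hz] at h
    have hd := hdd z hz
    field_simp
    linarith
  have hCR1' : ∀ s : ℝ, ∀ z ∈ I, fderiv ℝ F₁ (s, z) ((0 : ℝ), (1 : ℝ)) = (dd z * Et z) * A' s := by
    intro s z hz
    rw [hCR1 s z hz, hsF₂ s z hz]
    ring
  have hid : ∀ s : ℝ, ∀ z ∈ I, (dd z * Et z) * A'' s + P z * A s + Q z = 0 := fun s z hz =>
    sProfile_identity_of_CR hI hF₁ (dE := fun z => dd z * Et z) (EP := fun z => Et' z / dd z) (GP := fun z => G' z / dd z)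
      hA' hCR1' hCR2' hP hQ s hz
  -- (d) `∂_s F₁` as the derivative of the slice
  have hsF₁ : ∀ z ∈ I, ∀ s : ℝ, HasDerivAt (fun s' : ℝ => F₁ (s', z)) (c - (G' z / dd z + Et' z / dd z * A s)) s := by
    intro z hz s
    have h := hasDerivAt_slice_fst (hF₁d s z hz)
    rw [hCR2' s z hz] at h
    exact h
  -- (e) the dichotomy on `A`
  rcases const_or_sinusoid_of_ode_bounded (mul_ne_zero (hdd z₀ hz₀) (hEt0 z₀ hz₀)) hA hA' (fun s => hid s z₀ hz₀) hAbdd with hconst | hosc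
  · -- s-FREE BRANCH
    left
    have hA'0 : ∀ s, A' s = 0 := by
      intro s
      have h1 : HasDerivAt A 0 s := by
        have : A = fun _ => A 0 := funext hconst
        rw [this]; exact hasDerivAt_const s (A 0)
      exact (hA s).unique h1
    intro s z hz
    refine ⟨?_, by rw [hsF₂ s z hz, hA'0 s, mul_zero]⟩
    -- `F₁(·,z)` is affine with slope `q z`, bounded ⇒ slope zero
    set q : ℝ := c - (G' z / dd z + Et' z / dd z * A 0) with hq
    have hder : ∀ s' : ℝ, HasDerivAt (fun s' : ℝ => F₁ (s', z)) q s' := by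
      intro s'
      have h := hsF₁ z hz s'
      rw [hconst s'] at h
      exact h
    have haff : ∀ s' : ℝ, F₁ (s', z) = F₁ (0, z) + q * s' := fun s' => affine_of_hasDerivAt_const hder s'
    have hq0 : q = 0 := slope_eq_zero_of_bounded_affine (a := F₁ (0, z)) (M := B z) fun s' => by
      rw [← haff s']; exact hF₁bdd z hz s'
    rw [hCR2' s z hz, hconst s, ← hq, hq0]
  · -- OSCILLATORY BRANCH
    right
    obtain ⟨w, k, c₁, c₂, hw, hc, hAform⟩ := hosc
    have hwne : w ≠ 0 := hw.ne'
    -- the derivative of `A`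
    have hA'form : ∀ s, A' s = -c₁ * w * Real.sin (w * s) + c₂ * w * Real.cos (w * s) := by
      intro s
      have h1 : HasDerivAt A (-c₁ * w * Real.sin (w * s) + c₂ * w * Real.cos (w * s)) s := by
        have e1 : A = fun x => k + c₁ * Real.cos (w * x) + c₂ * Real.sin (w * x) := funext hAform
        rw [e1]
        have h := (((hasDerivAt_cos_mul w s).const_mul c₁).const_add k).add ((hasDerivAt_sin_mul w s).const_mul c₂)
        exact h.congr_deriv (by ring)
      exact (hA s).unique h1
    refine ⟨w, hw, fun z => F₁ (0, z) - Et' z / dd z * c₂ / w, fun z => Et' z / dd z * c₂ / w, fun z => -(Et' z / dd z * c₁ / w),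
      fun z => G z + Et z * k, fun z => Et z * c₁, fun z => Et z * c₂, fun z hz => ?_, fun s z hz => ⟨?_, ?_⟩⟩
    · rcases hc with h1 | h2
      · exact Or.inl (mul_ne_zero (hEt0 z hz) h1)
      · exact Or.inr (mul_ne_zero (hEt0 z hz) h2)
    · -- `F₁(·,z)`: derivative `q + p′(s)` with `p` bounded ⇒ `q = 0`, `F₁ = F₁(0) + p − p(0)`
      have hφ : ∀ s' : ℝ, HasDerivAt (fun s' : ℝ => F₁ (s', z))
          ((c - (G' z / dd z + Et' z / dd z * k)) + (-(Et' z / dd z) * (c₁ * Real.cos (w * s') + c₂ * Real.sin (w * s')))) s' := by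
        intro s'
        have h := hsF₁ z hz s'
        rw [hAform s'] at h
        exact h.congr_deriv (by ring)
      have hpd : ∀ s' : ℝ, HasDerivAt (fun s' : ℝ => -(Et' z / dd z) * (c₁ * Real.sin (w * s') - c₂ * Real.cos (w * s')) / w)
          (-(Et' z / dd z) * (c₁ * Real.cos (w * s') + c₂ * Real.sin (w * s'))) s' := by
        intro s'
        have h := ((((hasDerivAt_sin_mul w s').const_mul c₁).sub ((hasDerivAt_cos_mul w s').const_mul c₂)).const_mul
          (-(Et' z / dd z))).div_const w
        exact h.congr_deriv (by field_simp; ring)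
      have hpb : ∀ s' : ℝ, |-(Et' z / dd z) * (c₁ * Real.sin (w * s') - c₂ * Real.cos (w * s')) / w| ≤
          |Et' z / dd z| * (|c₁| + |c₂|) / w := by
        intro s'
        rw [abs_div, abs_mul, abs_neg, abs_of_pos hw]
        have h1 : |c₁ * Real.sin (w * s') - c₂ * Real.cos (w * s')| ≤ |c₁| + |c₂| :=
          calc |c₁ * Real.sin (w * s') - c₂ * Real.cos (w * s')|
              ≤ |c₁ * Real.sin (w * s')| + |c₂ * Real.cos (w * s')| := abs_sub _ _
            _ ≤ |c₁| + |c₂| := add_le_add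
                (by rw [abs_mul]; exact mul_le_of_le_one_right (abs_nonneg _) (Real.abs_sin_le_one _))
                (by rw [abs_mul]; exact mul_le_of_le_one_right (abs_nonneg _) (Real.abs_cos_le_one _))
        exact div_le_div_of_nonneg_right (mul_le_mul_of_nonneg_left h1 (abs_nonneg _)) hw.le
      obtain ⟨-, hform⟩ := eq_add_of_hasDerivAt_bounded hφ hpd hpb (hF₁bdd z hz)
      rw [hform s]
      simp only [Real.sin_zero, Real.cos_zero, mul_zero, mul_one, zero_sub]
      field_simp
      ring
    · rw [hsep s z hz, hAform s]
      ring

end Summit.NavierStokesRegularity.NavierStokesRegularity.Theorems.PoloidalWindowDoorLrcModEntireSonicSheetTrig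

end
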